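import Mathlib
import Summits.RiemannHypothesis.RiemannHypothesis.Theorems.WeilParityOffLineParityDetectionTrialIntegrals
import Summits.RiemannHypothesis.RiemannHypothesis.Theorems.WeilParityOffLineParityDetectionTrialCutoff
import Summits.RiemannHypothesis.RiemannHypothesis.Theorems.WeilParityOffLineParityDetectionTrialTransforms
import Literature.NumberTheory.LFunctions.WeilMellinBounds
import HarnessLib

/-!
# The dominant-quadruple gain of the odd trial function

Route `WeilParity`, crux `OffLineParityDetection` (item stmt-RiemannHypothesis-15431), line
`registered`, stub `stub_dominantQuadrupleOddTrial` (TRIAL).  Helper file (no zeta facts, no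
definitions): the analytic heart of the stub.  For the odd trial function `f = χ s`
(`s = sinh(η·) cos(γ·)`, `χ` the even plateau of the window `[-a, a]` with transition width
`δ ≤ 1/(16 r)`, `r² = η² + γ²`) at a phase `cos(2γa) = η/r`, `sin(2γa) = γ/r` and `a` large
(`sinh(ηa) cosh(ηa) ≥ 16 a r ⊔ 4`):

* `trial_dominant_bound` — `Re f̂(ρ⋆)² - x(a) ∫ f² ≥ (sinh(ηa) cosh(ηa))² / (2 r²)` at the dominant
  point `ρ⋆ = 1/2 + η + iγ`, where `x(a) = ∫_{[-a,a]} sinh²(ηt) sin²(γt) dt` is the Cauchy–Schwarz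
  threshold: with `P = Re f̂(ρ⋆) = ∫ f s ≥ N = ∫ f²`, `G = Im f̂(ρ⋆) = ∫ f cosh sin`,
  `Re f̂² - x N = P² - G² - x N ≥ N (P - x) - G²`, and `N, P - x ≥ 13 M/16`, `|G| ≤ M/8`
  (`M = sinh(ηa) cosh(ηa) / r`) by the closed forms of the helper file `…TrialIntegrals`;
* `trial_exists_oddTest` — the packaged odd Weil test of the window: real, odd, supported in
  `[-a, a]`, nonzero in `L²`, with `‖o‖₁ + ‖o″‖₁ ≤ C a e^{ηa}`, `∫ |o|² ≤ C a e^{2ηa}` and dominant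
  gain `≥ e^{4ηa} / C`, for ONE constant `C = C(η, γ)` and every phase window `a ≥ 1` with
  `C a ≤ e^{2ηa}`.

Everything is folklore analysis and fully proved.
-/

set_option linter.dupNamespace false

noncomputable section

namespace Summit.RiemannHypothesis.RiemannHypothesis.Theorems.WeilParityOffLineParityDetection

open MeasureTheory Set Real
open scoped ComplexConjugate
open Literature.NumberTheory.LFunctions

/-- **The dominant gain.** See the module docstring. [folklore] -/
theorem trial_dominant_bound {χ : ℝ → ℝ} {η γ a δ : ℝ} (hη : 0 < η) (ha : 1 ≤ a) (hδ : 0 < δ)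
    (hδ2 : δ ≤ 1 / 2) (hδr : δ * Real.sqrt (η ^ 2 + γ ^ 2) ≤ 1 / 16)
    (hfc : Continuous fun t ↦ χ t * (Real.sinh (η * t) * Real.cos (γ * t)))
    (hχ0 : ∀ t, 0 ≤ χ t) (hχ1 : ∀ t, χ t ≤ 1) (hχin : ∀ t, |t| ≤ a - δ → χ t = 1)
    (hχout : ∀ t, a ≤ |t| → χ t = 0) (hχev : ∀ t, χ (-t) = χ t)
    (hcos : Real.cos (2 * γ * a) = η / Real.sqrt (η ^ 2 + γ ^ 2))
    (hsin : Real.sin (2 * γ * a) = γ / Real.sqrt (η ^ 2 + γ ^ 2))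
    (hM1 : 16 * a * Real.sqrt (η ^ 2 + γ ^ 2) ≤ Real.sinh (η * a) * Real.cosh (η * a))
    (hM2 : 4 ≤ Real.sinh (η * a) * Real.cosh (η * a)) :
    (Real.sinh (η * a) * Real.cosh (η * a)) ^ 2 / (2 * (η ^ 2 + γ ^ 2)) ≤
      ((weilMellin (fun t ↦ ((χ t * (Real.sinh (η * t) * Real.cos (γ * t)) : ℝ) : ℂ))
          ⟨1 / 2 + η, γ⟩) ^ 2).re -
        (∫ t in Icc (-a) a, Real.sinh (η * t) ^ 2 * Real.sin (γ * t) ^ 2) *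
          ∫ t, (χ t * (Real.sinh (η * t) * Real.cos (γ * t))) ^ 2 := by
  -- the sizes
  set r := Real.sqrt (η ^ 2 + γ ^ 2) with hr
  have hr2 : r ^ 2 = η ^ 2 + γ ^ 2 := Real.sq_sqrt (by positivity)
  have hrpos : 0 < r := Real.sqrt_pos.2 (by positivity)
  have ha0 : 0 ≤ a := by linarith
  set sa := Real.sinh (η * a) with hsa_def
  set ca := Real.cosh (η * a) with hca_def
  have hsa : 0 < sa := Real.sinh_pos_iff.2 (by positivity)
  have hca : sa ≤ ca := (Real.sinh_lt_cosh _).le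
  set M := sa * ca / r with hM
  have hscM : sa * ca = M * r := by rw [hM]; field_simp
  have hMpos : 0 < M := by positivity
  have hM16 : 16 * a ≤ M := by
    rw [hM, le_div_iff₀ hrpos]
    exact hM1
  have hM4 : 1 / r ≤ M / 4 := by
    rw [div_le_div_iff₀ hrpos (by norm_num : (0 : ℝ) < 4), ← hscM]
    linarith
  have hδa : δ ≤ a := by linarith
  have hsinh2 : Real.sinh (2 * η * a) = 2 * sa * ca := by
    rw [show 2 * η * a = 2 * (η * a) by ring, Real.sinh_two_mul]
  -- the real trial function `f = χ s`
  set S : ℝ → ℝ := fun t ↦ Real.sinh (η * t) * Real.cos (γ * t) with hS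
  have hSc : Continuous S := by simp only [hS]; fun_prop
  have hS2c : Continuous fun t ↦ S t ^ 2 := hSc.pow 2
  have hout : ∀ t, t ∉ Icc (-a) a → a ≤ |t| := fun t ht ↦ by
    simp only [mem_Icc, not_and_or, not_le] at ht
    rcases ht with h1 | h1
    · exact (show a ≤ -t by linarith).trans (neg_le_abs t)
    · exact h1.le.trans (le_abs_self t)
  have hfs : HasCompactSupport fun t ↦ χ t * S t :=
    HasCompactSupport.intro (K := Icc (-a) a) isCompact_Icc fun t ht ↦ by
      simp only [hχout t (hout t ht), zero_mul]
  -- `P = Re`, `G = Im`, `N = ∫ f²`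
  set P := ∫ t, χ t * S t * S t with hP
  set G := ∫ t, χ t * S t * (Real.cosh (η * t) * Real.sin (γ * t)) with hG
  set N := ∫ t, (χ t * S t) ^ 2 with hN
  have hreim := trial_re_im_dominant hfc hfs hχev
  have hR : ((weilMellin (fun t ↦ ((χ t * S t : ℝ) : ℂ)) ⟨1 / 2 + η, γ⟩) ^ 2).re = P ^ 2 - G ^ 2 := by
    rw [sq, Complex.mul_re, hreim.1, hreim.2]
    ring
  set Sa := ∫ t in Icc (-a) a, Real.sinh (η * t) ^ 2 * Real.sin (γ * t) ^ 2 with hSa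
  have hSa0 : 0 ≤ Sa := trial_threshold_nonneg η γ a
  -- comparisons `N ≤ P`, `∫_{[-b,b]} s² ≤ N`
  have hN0 : 0 ≤ N := integral_nonneg fun t ↦ sq_nonneg _
  have hNP : N ≤ P := trial_norm_sq_le_re hfc hfs hSc hχ0 hχ1
  set b := a - δ with hb
  have hb0 : 0 ≤ b := by linarith
  have hPin : ∫ t in Icc (-b) b, S t ^ 2 ≤ N := trial_inner_le_norm_sq hfc hfs hSc hχin
  rw [trial_integral_Icc_eq hb0] at hPin
  -- the boundary layer costs at most `2 δ sa²`
  have hlayer : (∫ t in (-a)..a, S t ^ 2) - ∫ t in (-b)..b, S t ^ 2 ≤ 2 * δ * sa ^ 2 := by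
    have hB : ∀ t, |t| ≤ a → |S t ^ 2| ≤ sa ^ 2 := fun t hta ↦ by
      rw [abs_of_nonneg (sq_nonneg _)]
      calc S t ^ 2 = Real.sinh (η * t) ^ 2 * Real.cos (γ * t) ^ 2 := by simp only [hS]; ring
        _ ≤ Real.sinh (η * t) ^ 2 * 1 :=
            mul_le_mul_of_nonneg_left (Real.cos_sq_le_one _) (sq_nonneg _)
        _ ≤ Real.sinh (|η| * a) ^ 2 := by rw [mul_one]; exact trial_sinh_sq_le_window hta
        _ = sa ^ 2 := by rw [abs_of_pos hη]
    have h := trial_layer_le hS2c hb0 (by linarith) hB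
    have h' := le_abs_self ((∫ t in (-a)..a, S t ^ 2) - ∫ t in (-b)..b, S t ^ 2)
    calc _ ≤ _ := h'
      _ ≤ 2 * (a - b) * sa ^ 2 := h
      _ = 2 * δ * sa ^ 2 := by rw [hb]; ring
  -- the gap `∫_{-a}^{a} s² - x(a) ≥ M - a`
  have hSa_eq : Sa = ∫ t in (-a)..a, Real.sinh (η * t) ^ 2 * Real.sin (γ * t) ^ 2 :=
    trial_integral_Icc_eq ha0
  have hsc : Continuous fun t ↦ Real.sinh (η * t) ^ 2 * Real.sin (γ * t) ^ 2 := by fun_prop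
  have hgap : M - a ≤ (∫ t in (-a)..a, S t ^ 2) - Sa := by
    have h1 := trial_gap_integral_ge η γ a ha0
    have h2 := trial_phase_gap_ge hη hcos hsin
    have hsub : ∫ t in (-a)..a, (Real.sinh (η * t) ^ 2 * Real.cos (γ * t) ^ 2 -
        Real.sinh (η * t) ^ 2 * Real.sin (γ * t) ^ 2) = (∫ t in (-a)..a, S t ^ 2) - Sa := by
      rw [hSa_eq, ← intervalIntegral.integral_sub (hS2c.intervalIntegrable _ _)
        (hsc.intervalIntegrable _ _)]
      congr 1 with t
      simp only [hS]
      ring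
    rw [← hsub]
    have hM' : M = Real.sinh (2 * η * a) / r / 2 := by rw [hsinh2, hM]; ring
    rw [hM']
    linarith only [h1, h2]
  -- the small terms
  have hδM : 2 * δ * sa ^ 2 ≤ M / 8 := by
    have hss : sa ^ 2 ≤ sa * ca := by rw [sq]; exact mul_le_mul_of_nonneg_left hca hsa.le
    calc 2 * δ * sa ^ 2 ≤ 2 * δ * (sa * ca) := mul_le_mul_of_nonneg_left hss (by positivity)
      _ = 2 * M * (δ * r) := by rw [hscM]; ring
      _ ≤ 2 * M * (1 / 16) := mul_le_mul_of_nonneg_left hδr (by positivity)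
      _ = M / 8 := by ring
  have ha16 : a ≤ M / 16 := by linarith only [hM16]
  have hNlow : 13 * M / 16 ≤ N := by linarith only [hPin, hlayer, hgap, hSa0, hδM, ha16]
  have hPSlow : 13 * M / 16 ≤ P - Sa := by linarith only [hNP, hPin, hlayer, hgap, hδM, ha16]
  -- the cross term
  have hGb : |G| ≤ M / 8 := by
    have h := trial_cross_le hη hδ hδa hfc hχ0 hχ1 hχin hχout hcos hsin
    have h3 : 2 * δ * Real.sinh (2 * η * a) = 4 * (δ * r) * M := by
      rw [hsinh2, show 2 * sa * ca = 2 * (sa * ca) by ring, hscM]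
      ring
    have h4 : 4 * (δ * r) * M ≤ M / 4 := by
      calc 4 * (δ * r) * M ≤ 4 * (1 / 16) * M :=
            mul_le_mul_of_nonneg_right (mul_le_mul_of_nonneg_left hδr (by norm_num)) hMpos.le
        _ = M / 4 := by ring
    calc |G| ≤ (1 / r + 2 * δ * Real.sinh (2 * η * a)) / 4 := h
      _ ≤ (M / 4 + M / 4) / 4 := by
          rw [h3]
          exact div_le_div_of_nonneg_right (add_le_add hM4 h4) (by norm_num)
      _ = M / 8 := by ring
  -- assembly
  rw [hR]
  have hL : (sa * ca) ^ 2 / (2 * (η ^ 2 + γ ^ 2)) = M ^ 2 / 2 := by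
    rw [← hr2, hscM]
    field_simp
  rw [hL]
  have key : N * (P - Sa) - G ^ 2 ≤ P ^ 2 - G ^ 2 - Sa * N := by
    have h := mul_nonneg (hN0.trans hNP) (sub_nonneg.2 hNP)
    linarith only [h]
  have hNP2 : (13 * M / 16) * (13 * M / 16) ≤ N * (P - Sa) :=
    mul_le_mul hNlow hPSlow (by positivity) hN0
  have hG2 : G ^ 2 ≤ (M / 8) ^ 2 := by
    rw [← sq_abs G]
    exact pow_le_pow_left₀ (abs_nonneg _) hGb 2
  linarith only [key, hNP2, hG2, sq_nonneg M]

/-- **The packaged odd trial test of a phase window.** For `η > 0` and a frequency `γ` there is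
ONE constant `C = C(η, γ) > 0` such that on every window `a ≥ 1` in the phase class
`cos(2γa) = η/r`, `sin(2γa) = γ/r` (`r² = η² + γ²`) with `C a ≤ e^{2ηa}`, the odd trial function
`o = χ · sinh(η·) cos(γ·)` (plateau width `δ = 1/(16(r+1))`) is a real odd Weil test supported in
`[-a, a]`, nonzero in `L²`, with `‖o‖₁ + ‖o″‖₁ ≤ C a e^{ηa}`, `∫|o|² ≤ C a e^{2ηa}`, and dominant
gain `Re ô(ρ⋆)² - x(a) ∫|o|² ≥ e^{4ηa}/C` at `ρ⋆ = 1/2 + η + iγ`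
(`x(a) = ∫_{[-a,a]} sinh²(ηt) sin²(γt) dt`). [folklore] -/
theorem trial_exists_oddTest :
    ∀ (η γ : ℝ), 0 < η → ∃ C : ℝ, 0 < C ∧ ∀ a : ℝ, 1 ≤ a →
      Real.cos (2 * γ * a) = η / Real.sqrt (η ^ 2 + γ ^ 2) →
      Real.sin (2 * γ * a) = γ / Real.sqrt (η ^ 2 + γ ^ 2) →
      C * a ≤ Real.exp (2 * η * a) →
      ∃ o : ℝ → ℂ, IsWeilTest o ∧ tsupport o ⊆ Set.Icc (-a) a ∧ (∀ t, o (-t) = -o t) ∧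
        (∀ t, (o t).im = 0) ∧ 0 < ∫ t, ‖o t‖ ^ 2 ∧
        (∫ t, ‖o t‖) + ∫ t, ‖deriv (deriv o) t‖ ≤ C * a * Real.exp (η * a) ∧
        ∫ t, ‖o t‖ ^ 2 ≤ C * a * Real.exp (2 * η * a) ∧
        Real.exp (4 * η * a) / C ≤ ((weilMellin o ⟨1 / 2 + η, γ⟩) ^ 2).re -
          (∫ t in Set.Icc (-a) a, Real.sinh (η * t) ^ 2 * Real.sin (γ * t) ^ 2) * ∫ t, ‖o t‖ ^ 2 := by
  intro η γ hη
  set r := Real.sqrt (η ^ 2 + γ ^ 2) with hr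
  have hr2 : r ^ 2 = η ^ 2 + γ ^ 2 := Real.sq_sqrt (by positivity)
  have hrpos : 0 < r := Real.sqrt_pos.2 (by positivity)
  set δ : ℝ := 1 / (16 * (r + 1)) with hδ
  have hδpos : 0 < δ := by positivity
  have hδ2 : δ ≤ 1 / 2 := by
    rw [hδ, div_le_div_iff₀ (by positivity) (by norm_num)]
    linarith
  have hδr : δ * r ≤ 1 / 16 := by
    rw [hδ, div_mul_eq_mul_div, div_le_div_iff₀ (by positivity) (by norm_num)]
    linarith
  obtain ⟨C₀, hC₀, hbasic⟩ := trial_exists_oddTest_basic η δ γ hη hδpos hδ2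
  have hr2nn : (0 : ℝ) ≤ 512 * r ^ 2 := by positivity
  refine ⟨2 + C₀ + 512 * r ^ 2 + 256 * r + 64, by positivity, fun a ha hcos hsin hCa ↦ ?_⟩
  set C := 2 + C₀ + 512 * r ^ 2 + 256 * r + 64 with hC
  have hC64 : 64 ≤ C := by rw [hC]; linarith [hC₀.le, hrpos.le]
  have hC256 : 256 * r ≤ C := by rw [hC]; linarith [hC₀.le]
  have hC512 : 512 * r ^ 2 ≤ C := by rw [hC]; linarith [hC₀.le, hrpos.le]
  have hC2 : 2 + C₀ ≤ C := by rw [hC]; linarith [hrpos.le]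
  have hCpos : 0 < C := by linarith
  have ha0 : 0 < a := by linarith
  obtain ⟨χ, o, ho, hχ0, hχ1, hχin, hχout, hχev, hoW, hsupp, hodd, hreal, hNpos, hL1, hL2⟩ :=
    hbasic a ha
  -- sizes
  set sa := Real.sinh (η * a) with hsa_def
  set ca := Real.cosh (η * a) with hca_def
  set E := Real.exp (η * a) with hE
  have hEpos : 0 < E := Real.exp_pos _
  have hE2 : Real.exp (2 * η * a) = E ^ 2 := by
    rw [hE, ← Real.exp_nat_mul]; congr 1; push_cast; ring
  have hE4 : Real.exp (4 * η * a) = E ^ 4 := by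
    rw [hE, ← Real.exp_nat_mul]; congr 1; push_cast; ring
  have hsa0 : 0 < sa := Real.sinh_pos_iff.2 (by positivity)
  have hsc : sa ≤ ca := (Real.sinh_lt_cosh _).le
  have hcE : ca ≤ E := by
    rw [hca_def, hE, Real.cosh_eq]
    have h1 : Real.exp (-(η * a)) ≤ 1 := Real.exp_le_one_iff.2 (by nlinarith)
    have h2 : 1 ≤ Real.exp (η * a) := Real.one_le_exp (by positivity)
    linarith
  have hsE : sa ≤ E := hsc.trans hcE
  have hCE : C ≤ E ^ 2 := by
    have h1 : C ≤ C * a := le_mul_of_one_le_right hCpos.le ha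
    rw [← hE2]
    exact h1.trans hCa
  have hE8 : 2 ≤ E := by
    by_contra hlt
    have hlt' : E < 2 := lt_of_not_ge hlt
    have : E ^ 2 < 2 ^ 2 := pow_lt_pow_left₀ hlt' hEpos.le two_ne_zero
    linarith
  have hs4 : E / 4 ≤ sa := trial_exp_div_four_le_sinh hE8
  have hss : E ^ 2 / 16 ≤ sa * ca := by
    have h1 : (E / 4) ^ 2 ≤ sa ^ 2 := pow_le_pow_left₀ (by positivity) hs4 2
    have h2 : sa ^ 2 ≤ sa * ca := by rw [sq]; exact mul_le_mul_of_nonneg_left hsc hsa0.le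
    calc E ^ 2 / 16 = (E / 4) ^ 2 := by ring
      _ ≤ sa * ca := h1.trans h2
  have hCa16 : C * a / 16 ≤ sa * ca := by
    calc C * a / 16 ≤ Real.exp (2 * η * a) / 16 := by gcongr
      _ = E ^ 2 / 16 := by rw [hE2]
      _ ≤ sa * ca := hss
  have hM1 : 16 * a * r ≤ sa * ca := by
    calc 16 * a * r = 256 * r * a / 16 := by ring
      _ ≤ C * a / 16 := by gcongr
      _ ≤ sa * ca := hCa16
  have hM2 : 4 ≤ sa * ca := by
    calc (4 : ℝ) = 64 * 1 / 16 := by norm_num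
      _ ≤ C * a / 16 := by gcongr
      _ ≤ sa * ca := hCa16
  -- the real trial function
  have hof : o = fun t ↦ ((χ t * (Real.sinh (η * t) * Real.cos (γ * t)) : ℝ) : ℂ) := funext ho
  have hfc : Continuous fun t ↦ χ t * (Real.sinh (η * t) * Real.cos (γ * t)) := by
    have h := Complex.continuous_re.comp hoW.1.continuous
    have heq : Complex.re ∘ o = fun t ↦ χ t * (Real.sinh (η * t) * Real.cos (γ * t)) :=
      funext fun t ↦ by
        show (o t).re = _
        rw [ho t, Complex.ofReal_re]
    rwa [heq] at h
  have hN : ∫ t, ‖o t‖ ^ 2 = ∫ t, (χ t * (Real.sinh (η * t) * Real.cos (γ * t))) ^ 2 := by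
    congr 1 with t
    rw [ho t, Complex.norm_real, Real.norm_eq_abs, sq_abs]
  have hdom := trial_dominant_bound hη ha hδpos hδ2 hδr hfc hχ0 hχ1 hχin hχout hχev hcos hsin hM1 hM2
  rw [← hof, ← hN] at hdom
  refine ⟨o, hoW, hsupp, hodd, hreal, hNpos, ?_, ?_, ?_⟩
  · -- `‖o‖₁ + ‖o″‖₁`
    calc (∫ t, ‖o t‖) + ∫ t, ‖deriv (deriv o) t‖ ≤ 2 * a * sa + C₀ * a * ca := add_le_add hL1 hL2
      _ ≤ 2 * a * E + C₀ * a * E := by gcongr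
      _ = (2 + C₀) * a * E := by ring
      _ ≤ C * a * E := by gcongr
  · -- `∫ |o|²`
    have h1 : ∫ t, ‖o t‖ ^ 2 ≤ ∫ t in Icc (-a) a, (Real.sinh (η * t) * Real.cos (γ * t)) ^ 2 := by
      rw [hN]
      exact trial_norm_sq_le_window hfc (by fun_prop) hχ0 hχ1 hχout
    have hb : ∀ t ∈ Icc (-a) a, ‖(Real.sinh (η * t) * Real.cos (γ * t)) ^ 2‖ ≤ sa ^ 2 := by
      intro t ht
      rw [Real.norm_eq_abs, abs_of_nonneg (sq_nonneg _), mul_pow]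
      have hta : |t| ≤ a := abs_le.2 ⟨ht.1, ht.2⟩
      calc Real.sinh (η * t) ^ 2 * Real.cos (γ * t) ^ 2 ≤ Real.sinh (η * t) ^ 2 * 1 :=
            mul_le_mul_of_nonneg_left (Real.cos_sq_le_one _) (sq_nonneg _)
        _ ≤ Real.sinh (|η| * a) ^ 2 := by rw [mul_one]; exact trial_sinh_sq_le_window hta
        _ = sa ^ 2 := by rw [abs_of_pos hη]
    have h2 := norm_setIntegral_le_of_norm_le_const (measure_Icc_lt_top (μ := volume)) hb
    rw [Real.volume_real_Icc_of_le (by linarith)] at h2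
    calc ∫ t, ‖o t‖ ^ 2 ≤ _ := h1
      _ ≤ _ := Real.le_norm_self _
      _ ≤ sa ^ 2 * (a - -a) := h2
      _ = 2 * a * sa ^ 2 := by ring
      _ ≤ 2 * a * E ^ 2 := by gcongr
      _ ≤ C * a * E ^ 2 := by gcongr; linarith
      _ = C * a * Real.exp (2 * η * a) := by rw [hE2]
  · -- the dominant gain
    calc Real.exp (4 * η * a) / C = E ^ 4 / C := by rw [hE4]
      _ ≤ E ^ 4 / (512 * r ^ 2) := div_le_div_of_nonneg_left (by positivity) (by positivity) hC512
      _ = (E ^ 2 / 16) ^ 2 / (2 * r ^ 2) := by ring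
      _ ≤ (sa * ca) ^ 2 / (2 * r ^ 2) := by gcongr
      _ = (sa * ca) ^ 2 / (2 * (η ^ 2 + γ ^ 2)) := by rw [hr2]
      _ ≤ _ := hdom

end Summit.RiemannHypothesis.RiemannHypothesis.Theorems.WeilParityOffLineParityDetection

end
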